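import Mathlib.LinearAlgebra.Matrix.PosDef
import Mathlib.Analysis.Matrix.Order
import Mathlib.Analysis.Complex.Order
import Mathlib.Data.Real.Basic
import HarnessLib

/-!
# Kernel-checkable positive-semidefiniteness certificates for rational matrices (`LDLᵀ` witnesses)

Topic `Literature/Analysis/ValidatedNumerics`. The certificate layer for "this explicit symmetric rational matrix is
positive semidefinite": a witness `(L, d)` with `M = L · diag d · Lᵀ` and `d ≥ 0` (e.g. the exact rational `LDLᵀ`
factorisation of a numerically positive definite matrix, or any weighted Gram decomposition), checked by `decide` /
`native_decide` on literal data (`Literature.Analysis.ValidatedNumerics.PSDCert.ldltCheck`), its soundness over `ℝ`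
(`posSemidef_map_of_ldltCheck`), the certified eigenvalue lower bound it yields
(`le_dotProduct_mulVec_of_posSemidef_sub`), and the realification of a Hermitian matrix given by rational real and
imaginary parts (`posSemidef_toComplex_of_realify`): `A + iB ⪰ 0` if `[[A, −B], [B, A]] ⪰ 0`.

This is the generic half of interval eigen-enclosure certificates for Hermitian matrix families (Bloch / dynamical
matrices: evaluate the family at a box corner in interval arithmetic, round the midpoint to rationals, subtract the
radius, certify the rational matrix by an `LDLᵀ` witness); cf. the model-specific
`posSemidef_sq_sub_smul_of_certificate` of `Literature/MathematicalPhysics/QuantumLattice/SpinChainsAkltCertificateProofs.lean`.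
No facts, no axioms.

## References
* N. J. Higham, *Accuracy and Stability of Numerical Algorithms*, 2nd ed., SIAM 2002, Ch. 10 (Cholesky / `LDLᵀ`). [folklore]
* S. M. Rump, *Verification of positive definiteness*, BIT 46 (2006) 433–452 (certifying definiteness a posteriori). [folklore]
-/

open Matrix
open scoped ComplexOrder

namespace Literature.Analysis.ValidatedNumerics.PSDCert

variable {n : Type*} [Fintype n] [DecidableEq n]

/-! ### `LDLᵀ` witnesses over `ℚ` -/

/-- `L · diag d · Lᵀ` with `d ≥ 0` is positive semidefinite over `ℝ`. [folklore] -/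
theorem posSemidef_ldlt_real (L : Matrix n n ℝ) (d : n → ℝ) (hd : ∀ i, 0 ≤ d i) :
    (L * diagonal d * Lᵀ).PosSemidef := by
  have hD : (diagonal d).PosSemidef := posSemidef_diagonal_iff.2 hd
  simpa [conjTranspose_eq_transpose_of_trivial] using hD.mul_mul_conjTranspose_same L

/-- Casting a rational `LDLᵀ` identity to `ℝ`. [folklore] -/
theorem map_ldlt (M L : Matrix n n ℚ) (d : n → ℚ) (h : M = L * diagonal d * Lᵀ) :
    M.map (Rat.castHom ℝ) =
      L.map (Rat.castHom ℝ) * diagonal (fun i => (d i : ℝ)) * (L.map (Rat.castHom ℝ))ᵀ := by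
  rw [h, Matrix.map_mul, Matrix.map_mul, transpose_map, diagonal_map (map_zero (Rat.castHom ℝ))]
  rfl

/-- **Soundness of an `LDLᵀ` witness**: if `M = L · diag d · Lᵀ` over `ℚ` with `d ≥ 0`, then `M` (cast to `ℝ`) is
positive semidefinite. [folklore] -/
theorem posSemidef_map_of_ldlt (M L : Matrix n n ℚ) (d : n → ℚ) (hd : ∀ i, 0 ≤ d i)
    (h : M = L * diagonal d * Lᵀ) : (M.map (Rat.castHom ℝ)).PosSemidef := by
  rw [map_ldlt M L d h]
  exact posSemidef_ldlt_real _ _ fun i => by exact_mod_cast hd i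

/-- The Boolean checker of an `LDLᵀ` witness (for `decide` / `native_decide` on literal data). [folklore] -/
def ldltCheck (M L : Matrix n n ℚ) (d : n → ℚ) : Bool :=
  decide (∀ i, 0 ≤ d i) && decide (M = L * diagonal d * Lᵀ)

/-- **Checker soundness.** [folklore] -/
theorem posSemidef_map_of_ldltCheck {M L : Matrix n n ℚ} {d : n → ℚ} (h : ldltCheck M L d = true) :
    (M.map (Rat.castHom ℝ)).PosSemidef := by
  simp only [ldltCheck, Bool.and_eq_true, decide_eq_true_eq] at h
  exact posSemidef_map_of_ldlt M L d h.1 h.2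

omit [DecidableEq n] in
/-- A certified lower eigenvalue bound: `M − c·1 ⪰ 0` gives `c·‖v‖² ≤ vᵀMv`. [folklore] -/
theorem le_dotProduct_mulVec_of_posSemidef_sub [DecidableEq n] {M : Matrix n n ℝ} {c : ℝ}
    (h : (M - c • (1 : Matrix n n ℝ)).PosSemidef) (v : n → ℝ) :
    c * (v ⬝ᵥ v) ≤ v ⬝ᵥ (M *ᵥ v) := by
  have h1 := h.dotProduct_mulVec_nonneg v
  rw [sub_mulVec, dotProduct_sub, smul_mulVec, one_mulVec, dotProduct_smul, star_trivial, smul_eq_mul,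
    sub_nonneg] at h1
  exact h1

/-! ### Realification of Hermitian matrices with rational real and imaginary parts -/

/-- The realification `[[A, −B], [B, A]]` of `A + iB`. [folklore] -/
def realify (A B : Matrix n n ℚ) : Matrix (n ⊕ n) (n ⊕ n) ℚ := fromBlocks A (-B) B A

/-- The complex matrix `A + iB`. [folklore] -/
def toComplex (A B : Matrix n n ℚ) : Matrix n n ℂ := fun i j => ⟨A i j, B i j⟩

omit [DecidableEq n] in
/-- Real part of the Hermitian form of `A + iB` at `x + iy` in terms of the realification:
`Re ⟨v, (A+iB)v⟩ = [x;y]ᵀ [[A,−B],[B,A]] [x;y]`. [folklore] -/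
theorem re_form_toComplex (A B : Matrix n n ℚ) (x y : n → ℝ) :
    (star (fun i => (⟨x i, y i⟩ : ℂ)) ⬝ᵥ (toComplex A B) *ᵥ fun i => (⟨x i, y i⟩ : ℂ)).re =
      Sum.elim x y ⬝ᵥ ((realify A B).map (Rat.castHom ℝ)) *ᵥ Sum.elim x y := by
  simp only [dotProduct, mulVec, Matrix.map_apply, toComplex, realify, Pi.star_apply, Fintype.sum_sum_type,
    Sum.elim_inl, Sum.elim_inr, fromBlocks_apply₁₁, fromBlocks_apply₁₂, fromBlocks_apply₂₁, fromBlocks_apply₂₂,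
    Complex.re_sum, Complex.mul_re, Complex.star_def, Complex.conj_re, Complex.conj_im,
    Complex.im_sum, Complex.mul_im, eq_ratCast]
  simp only [neg_mul, sub_neg_eq_add, Finset.sum_add_distrib, Finset.sum_sub_distrib]
  ring_nf
  simp only [Finset.sum_add_distrib, Finset.sum_sub_distrib, Finset.mul_sum]
  ring_nf
  simp only [Matrix.neg_apply, Rat.cast_neg, mul_neg, neg_mul, Finset.sum_neg_distrib]
  ring

omit [DecidableEq n] in
/-- **Realification criterion**: if `[[A, −B], [B, A]] ⪰ 0` over `ℝ` then `0 ≤ Re ⟨v, (A+iB) v⟩` for every complex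
`v`. [folklore] -/
theorem re_form_nonneg_of_realify {A B : Matrix n n ℚ} (h : ((realify A B).map (Rat.castHom ℝ)).PosSemidef)
    (v : n → ℂ) : 0 ≤ (star v ⬝ᵥ (toComplex A B) *ᵥ v).re := by
  have hv : v = fun i => (⟨(v i).re, (v i).im⟩ : ℂ) := by funext i; exact (Complex.eta (v i)).symm
  rw [hv, re_form_toComplex A B (fun i => (v i).re) (fun i => (v i).im)]
  simpa only [star_trivial] using h.dotProduct_mulVec_nonneg (Sum.elim (fun i => (v i).re) fun i => (v i).im)

omit [DecidableEq n] in
/-- **PSD of `A + iB` from its realification** (Hermitian data: `Aᵀ = A`, `Bᵀ = −B`). [folklore] -/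
theorem posSemidef_toComplex_of_realify {A B : Matrix n n ℚ} (hA : Aᵀ = A) (hB : Bᵀ = -B)
    (h : ((realify A B).map (Rat.castHom ℝ)).PosSemidef) : (toComplex A B).PosSemidef := by
  have herm : (toComplex A B).IsHermitian := by
    ext i j
    have h1 : A j i = A i j := by simpa using congrFun (congrFun hA i) j
    have h2 : B j i = -B i j := by simpa using congrFun (congrFun hB i) j
    apply Complex.ext <;> simp [toComplex, h1, h2]
  refine PosSemidef.of_dotProduct_mulVec_nonneg herm fun v => ?_
  have hre := re_form_nonneg_of_realify h v
  have hself : star (star v ⬝ᵥ (toComplex A B) *ᵥ v) = star v ⬝ᵥ (toComplex A B) *ᵥ v := by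
    conv_lhs => rw [star_dotProduct, star_star, star_mulVec, herm.eq, ← dotProduct_mulVec]
  have him : (star v ⬝ᵥ (toComplex A B) *ᵥ v).im = 0 := by
    have := congrArg Complex.im hself
    simp only [Complex.star_def, Complex.conj_im] at this
    linarith
  exact Complex.nonneg_iff.2 ⟨hre, him.symm⟩

/-- **The combined checker for a Hermitian matrix with Gaussian-rational entries**: symmetry of the data and an
`LDLᵀ` witness for the realification. [folklore] -/
def hermCheck (A B : Matrix n n ℚ) (L : Matrix (n ⊕ n) (n ⊕ n) ℚ) (d : n ⊕ n → ℚ) : Bool :=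
  decide (Aᵀ = A) && decide (Bᵀ = -B) && ldltCheck (realify A B) L d

/-- **Soundness of `hermCheck`.** [folklore] -/
theorem posSemidef_toComplex_of_hermCheck {A B : Matrix n n ℚ} {L : Matrix (n ⊕ n) (n ⊕ n) ℚ}
    {d : n ⊕ n → ℚ} (h : hermCheck A B L d = true) : (toComplex A B).PosSemidef := by
  simp only [hermCheck, Bool.and_eq_true, decide_eq_true_eq] at h
  exact posSemidef_toComplex_of_realify h.1.1 h.1.2 (posSemidef_map_of_ldltCheck h.2)

omit [Fintype n] [DecidableEq n] in
/-- `toComplex` is additive in the real part and sends `c • 1` to `c • 1`. [folklore] -/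
theorem toComplex_sub_smul_one [DecidableEq n] (A B : Matrix n n ℚ) (c : ℚ) :
    toComplex (A - c • (1 : Matrix n n ℚ)) B = toComplex A B - (c : ℂ) • (1 : Matrix n n ℂ) := by
  funext i j
  by_cases hij : i = j
  · subst hij
    apply Complex.ext <;> simp [toComplex]
  · apply Complex.ext <;> simp [toComplex, hij]

/-- **Certified eigenvalue lower bound for a Gaussian-rational Hermitian matrix**: a checked witness for
`(A − c·1) + iB` gives `c·‖v‖² ≤ Re⟨v, (A+iB)v⟩` for all complex `v`. [folklore] -/
theorem le_re_form_of_hermCheck_sub {A B : Matrix n n ℚ} {c : ℚ} {L : Matrix (n ⊕ n) (n ⊕ n) ℚ}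
    {d : n ⊕ n → ℚ} (h : hermCheck (A - c • (1 : Matrix n n ℚ)) B L d = true) (v : n → ℂ) :
    (c : ℝ) * (star v ⬝ᵥ v).re ≤ (star v ⬝ᵥ (toComplex A B) *ᵥ v).re := by
  have hpsd := posSemidef_toComplex_of_hermCheck h
  rw [toComplex_sub_smul_one] at hpsd
  have h1 := hpsd.dotProduct_mulVec_nonneg v
  rw [sub_mulVec, dotProduct_sub, smul_mulVec, one_mulVec, dotProduct_smul, sub_nonneg] at h1
  have h2 := Complex.le_def.1 h1
  simp only [smul_eq_mul, Complex.mul_re, Complex.ratCast_re, Complex.ratCast_im, zero_mul,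
    sub_zero] at h2
  exact_mod_cast h2.1

/-! ### A `2 × 2` smoke test evaluated by the kernel -/

/-- `[[2, 1], [1, 2]] = L·diag(2, 3/2)·Lᵀ` with `L = [[1, 0], [1/2, 1]]`. [folklore] -/
example : ldltCheck !![(2 : ℚ), 1; 1, 2] !![1, 0; 1 / 2, 1] ![2, 3 / 2] = true := by decide +kernel

end Literature.Analysis.ValidatedNumerics.PSDCert
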